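import Summits.ABC.IUTFork.LDHGenuine
import Literature.IUT.LogVolume.PilotSlotResidue
import HarnessLib

/-!
# The fork at [IUTchIII] Corollary 3.12, L-DH level: abc-iut-c312-d1's explicit Step (v) constant SPLITS as
# (Ind1) slot residue + the print-shaped different/tame terms

Record-only file (D-0012) of the abc-iut cell (campaign-S seat abc-iut-S8); TAKES NO SIDE. S. Mochizuki, *IUT IV*
[Mochizuki2012], proof of Thm. 1.10 Step (v) p. 27–28 (per collection: "`{−λ + d_I + 1}·log(p) + Σ_{i∈I*}{3 +
log(e_i)}`", with "`λ`" read at "`i† = j`"); Dupuy–Hilado, arXiv:2004.13228 [DupuyHilado2025] §4.7, §4.11–4.12;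
the cell's audit note HOME/plan/c312/STEPV-IND1-NOTE.md.

abc-iut-c312-d1's `DHData.explicitDelta I` (`LDHGenuine.lean`, the constant `δΣ(I)` for which
`hullEstimateOf_ofInput : I.HullEstimateOf (explicitDelta I)` is a THEOREM) is, per collection `v⃗`, the sum of
THREE terms: the (Ind1) slot term `θ_j(v⃗(j)) − min_a θ_j(v⃗(a))`, the different term `{d_I + 1}·log p`, and the
tame term `Σ_{a : e_a > p−2}{3 + log e_a}`. This file NAMES the weighted/procession average of the last two —
`explicitDeltaRest I`, the part that has the SHAPE of print's Step (v) display — and proves the split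
**`explicitDelta I = slotResidue I.X I.supportPrimes + explicitDeltaRest I`** (`explicitDelta_eq_slotResidue_add_rest`),
so that: (a) the computable half holds with `δ = slotResidue + explicitDeltaRest` (`hullEstimateOf_slotResidue_add_rest`);
(b) by the lower bound of `LDHSlotResidue.lean` every admissible `δ` is `≥ slotResidue`, i.e. the optimal discrepancy
of the genuine `−|log(Θ)|` lies in `[slotResidue, slotResidue + explicitDeltaRest]`; (c) a bound of the printed shape
for `explicitDeltaRest I` (abc-iut-c312-d1's S-a: different term ↦ `log(𝔡^K)` by abc-iut-S1's
`DifferentOrdGaloisFibre`, tame term ↦ `4(j+1)·ι·l⋇_mod` by (R4)) gives child (ii′) of stmt-ABC-19678 EXACTLY at the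
slot-constant data (`PilotData.slotResidue_eq_zero_of_const`), and at all data up to the residue.
[cite: Mochizuki2012, IUTchIV Thm. 1.10 Step (v) p. 27–28] [cite: DupuyHilado2025, §4.7, §4.11, §4.12]
[claim: Mochizuki2012, status: disputed] for every IUT quotation. Nothing asserted; no side taken on Cor. 3.12.
-/

noncomputable section

namespace Summit.ABC.IUTFork

open Literature.IUT.LogVolume NumberField IsDedekindDomain
open Literature.NumberTheory.GaloisRepresentations.Ultrametric

namespace DHData

variable {F₀ : Type} [Field F₀] [NumberField F₀] {K : Type} [Field K] [NumberField K] [Algebra F₀ K]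
variable (I : ThetaVolumeInput F₀ K)

/-- **The print-shaped part of `δΣ(I)`**: the weighted (`Π_k Pr(v⃗(k))`), procession-averaged (`1/ℓ⋇`), `p`-summed
(`p ∈ T(I)`) aggregate of the per-collection different and tame terms `{d_I + 1}·log p + Σ_{a : e_a > p−2}{3 + log e_a}`
of [IUTchIV] Thm. 1.10 Step (v) (abc-iut-c312-d1's `explicitDelta` with the (Ind1) slot term removed; `d_I` the
different sum and `e_a` the ramification indices of the GENUINE completions `K_{v̲_a}`).
[cite: Mochizuki2012, IUTchIV Thm. 1.10 Step (v) p. 27–28] -/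
def explicitDeltaRest : ℝ :=
  ∑ p ∈ I.supportPrimes, (1 / (I.X.lstar : ℝ)) * ∑ i : Fin I.X.lstar,
    ∑ e : Fin ((i : ℕ) + 1 + 1) → placesOver F₀ p,
      (fun (p j : ℕ) (e : Fin (j + 1) → placesOver F₀ p) =>
          if h : p.Prime ∧ 0 < j ∧ j - 1 < I.X.lstar then
            haveI : Fact p.Prime := ⟨h.1⟩
            (dSum p (fun a => (I.σ.localFieldFamily p h.1).k (e a)) + 1) * Real.log p
            + ∑ a ∈ Finset.univ.filter (fun a => p - 2 < absRamificationIdx p ((I.σ.localFieldFamily p h.1).k (e a))),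
                (3 + Real.log (absRamificationIdx p ((I.σ.localFieldFamily p h.1).k (e a))))
          else 0) p ((i : ℕ) + 1) e * ∏ k, weight F₀ (e k).1

/-- Per collection, at a prime `p` and degree `j = i+1`: c312-d1's summand is the slot defect
`θ_j(v⃗(j)) − min_k θ_j(v⃗(k))` plus the print-shaped summand. [cite: Mochizuki2012, IUTchIV Thm. 1.10 Step (v) p. 27–28] -/
private theorem summand_split {p : ℕ} (hp : p.Prime) (i : Fin I.X.lstar)
    (e : Fin ((i : ℕ) + 1 + 1) → placesOver F₀ p) :
    (fun (p j : ℕ) (e : Fin (j + 1) → placesOver F₀ p) =>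
          if h : p.Prime ∧ 0 < j ∧ j - 1 < I.X.lstar then
            haveI : Fact p.Prime := ⟨h.1⟩
            (I.X.thetaPilot ⟨j - 1, h.2.2⟩ (e (Fin.last j)).1 * logNorm F₀ (e (Fin.last j)).1
                / localDegree F₀ (e (Fin.last j)).1
              - Finset.univ.inf' ⟨0, Finset.mem_univ _⟩ (fun a =>
                  I.X.thetaPilot ⟨j - 1, h.2.2⟩ (e a).1 * logNorm F₀ (e a).1 / localDegree F₀ (e a).1))
            + (dSum p (fun a => (I.σ.localFieldFamily p h.1).k (e a)) + 1) * Real.log p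
            + ∑ a ∈ Finset.univ.filter (fun a => p - 2 < absRamificationIdx p ((I.σ.localFieldFamily p h.1).k (e a))),
                (3 + Real.log (absRamificationIdx p ((I.σ.localFieldFamily p h.1).k (e a))))
          else 0) p ((i : ℕ) + 1) e =
      (I.X.slotValue i (e (Fin.last _)).1
        - Finset.univ.inf' Finset.univ_nonempty (fun k => I.X.slotValue i (e k).1))
      + (fun (p j : ℕ) (e : Fin (j + 1) → placesOver F₀ p) =>
          if h : p.Prime ∧ 0 < j ∧ j - 1 < I.X.lstar then
            haveI : Fact p.Prime := ⟨h.1⟩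
            (dSum p (fun a => (I.σ.localFieldFamily p h.1).k (e a)) + 1) * Real.log p
            + ∑ a ∈ Finset.univ.filter (fun a => p - 2 < absRamificationIdx p ((I.σ.localFieldFamily p h.1).k (e a))),
                (3 + Real.log (absRamificationIdx p ((I.σ.localFieldFamily p h.1).k (e a))))
          else 0) p ((i : ℕ) + 1) e := by
  have h : p.Prime ∧ 0 < (i : ℕ) + 1 ∧ (i : ℕ) + 1 - 1 < I.X.lstar := ⟨hp, Nat.succ_pos _, by simp [i.2]⟩
  have hidx : (⟨(i : ℕ) + 1 - 1, h.2.2⟩ : Fin I.X.lstar) = i := Fin.ext (by simp)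
  simp only [dif_pos h, hidx, PilotData.slotValue]
  have hinf : Finset.univ.inf' ⟨0, Finset.mem_univ _⟩
        (fun a : Fin ((i : ℕ) + 1 + 1) => I.X.thetaPilot i (e a).1 * logNorm F₀ (e a).1 / localDegree F₀ (e a).1) =
      Finset.univ.inf' Finset.univ_nonempty
        (fun k : Fin ((i : ℕ) + 1 + 1) => I.X.thetaPilot i (e k).1 * logNorm F₀ (e k).1 / localDegree F₀ (e k).1) :=
    rfl
  rw [hinf]
  ring

/-- **The split**: `explicitDelta I = slotResidue I.X I.supportPrimes + explicitDeltaRest I` — c312-d1's explicit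
Step (v) constant is the (Ind1) slot residue of the pilot data plus its print-shaped part (every `p ∈ T(I)` is
prime, so the guards are satisfied and the per-collection split `summand_split` sums up).
[cite: Mochizuki2012, IUTchIV Thm. 1.10 Step (v) p. 27–28] -/
theorem explicitDelta_eq_slotResidue_add_rest :
    explicitDelta I = I.X.slotResidue I.supportPrimes + explicitDeltaRest I := by
  rw [PilotData.slotResidue_eq_sum, explicitDelta, explicitDeltaRest, ← Finset.sum_add_distrib]
  refine Finset.sum_congr rfl fun p hp => ?_
  rw [← mul_add, ← Finset.sum_add_distrib]
  congr 1
  refine Finset.sum_congr rfl fun i _ => ?_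
  rw [← Finset.sum_add_distrib]
  refine Finset.sum_congr rfl fun e _ => ?_
  rw [← add_mul, summand_split I (I.prime_of_mem_supportPrimes hp) i e]

/-- **The computable half with the residue isolated**: `I.HullEstimateOf (slotResidue + explicitDeltaRest)` for
every genuine input (c312-d1's `hullEstimateOf_ofInput` rewritten through the split).
[cite: Mochizuki2012, IUTchIV Thm. 1.10 Steps (iv)–(viii) p. 26–30] -/
theorem hullEstimateOf_slotResidue_add_rest :
    I.HullEstimateOf (I.X.slotResidue I.supportPrimes + explicitDeltaRest I) := by
  rw [← explicitDelta_eq_slotResidue_add_rest]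
  exact hullEstimateOf_ofInput I

/-- **Slot-constant inputs**: if `θ_j` is constant on `V(F_mod)_p` for every `p ∈ T(I)` (in particular
`F_mod = ℚ`), the residue vanishes and `I.HullEstimateOf (explicitDeltaRest I)` — the computable half with the
PRINT-SHAPED constant alone. [cite: Mochizuki2012, IUTchIV Thm. 1.10 Step (v) p. 28] -/
theorem hullEstimateOf_rest_of_const
    (h : ∀ p ∈ I.supportPrimes, ∀ (i : Fin I.X.lstar) (v w : placesOver F₀ p),
      I.X.slotValue i v.1 = I.X.slotValue i w.1) :
    I.HullEstimateOf (explicitDeltaRest I) := by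
  have h0 := hullEstimateOf_slotResidue_add_rest I
  rwa [I.X.slotResidue_eq_zero_of_const I.supportPrimes h, zero_add] at h0

/-- **`F_mod` of degree one** (one place over each prime): `I.HullEstimateOf (explicitDeltaRest I)`.
[cite: Mochizuki2012, IUTchIV Thm. 1.10 Step (v) p. 28] -/
theorem hullEstimateOf_rest_of_finrank_eq_one (hF : Module.finrank ℚ F₀ = 1) :
    I.HullEstimateOf (explicitDeltaRest I) := by
  have h0 := hullEstimateOf_slotResidue_add_rest I
  rwa [I.X.slotResidue_eq_zero_of_finrank_eq_one I.supportPrimes (fun _ hp => I.prime_of_mem_supportPrimes hp) hF,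
    zero_add] at h0

/-- `0 ≤ explicitDeltaRest I` (every per-collection term is a nonnegative different/tame contribution times a
nonnegative weight). [cite: Mochizuki2012, IUTchIV Thm. 1.10 Step (v) p. 27–28] -/
theorem explicitDeltaRest_nonneg : 0 ≤ explicitDeltaRest I := by
  unfold explicitDeltaRest
  refine Finset.sum_nonneg fun p hp => mul_nonneg (by positivity) (Finset.sum_nonneg fun i _ =>
    Finset.sum_nonneg fun e _ => mul_nonneg ?_ (PilotData.prod_weight_nonneg e))
  have h : p.Prime ∧ 0 < (i : ℕ) + 1 ∧ (i : ℕ) + 1 - 1 < I.X.lstar :=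
    ⟨I.prime_of_mem_supportPrimes hp, Nat.succ_pos _, by simp [i.2]⟩
  simp only [dif_pos h]
  haveI : Fact p.Prime := ⟨h.1⟩
  have hlogp : 0 ≤ Real.log p := Real.log_nonneg (by exact_mod_cast h.1.one_lt.le)
  refine add_nonneg (mul_nonneg (add_nonneg ?_ zero_le_one) hlogp) (Finset.sum_nonneg fun a _ => ?_)
  · exact Finset.sum_nonneg fun a _ => differentOrd_nonneg p _
  · have : (1 : ℝ) ≤ absRamificationIdx p ((I.σ.localFieldFamily p h.1).k (e a)) := by
      exact_mod_cast absRamificationIdx_pos p _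
    have := Real.log_nonneg this
    linarith

end DHData

end Summit.ABC.IUTFork

end
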